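import Summits.AtomisticToContinuum.FouriersLaw.Theses.CageBudgetFekete
import Summits.AtomisticToContinuum.FouriersLaw.Theorems.CoercivePulseLinearCeilingOfUniformAbelianRegularity
import HarnessLib

/-!
# Split glue for crux `CageBudgetFekete.HeatVarianceCeiling` (item stmt-AtomisticToContinuum-15770): the two pieces
(crux-strategist p1, 2026-08-17; `--supports` file, closes nothing)

The ceiling crux (C) `V_T(τ) ≤ B·τ` decomposes into
* piece 1 (OPEN, existing shared item stmt-AtomisticToContinuum-13416): (R) = `CageBudgetFekete.UniformAbelianRegularity` — N-uniform
  Abelian regularity of the OPEN chain's equilibrium total-current autocorrelation;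
* piece 2 (PROVED here, `abelEnvelope_holds`): for every symmetric infinite-volume pair `(μ, D)`, bounded Abel means
  `∫₀^∞ e^{−νt} C_T(t) dt ≤ B` on `ν ∈ (0, ν₀)` imply the linear ceiling `2∫₀^τ (τ−s) C_T(s) ds ≤ b·τ` for all `τ ≥ 0`
  (cosine-Bochner representation of `C_T` + the Fejér ≤ 8t·Abel(1/t) kernel comparison; landed SpikeLemma stubs
  `stub_spectralRepresentation`, `stub_envelopeOfSpectralAbelBound`);
with the glue `heatVarianceCeiling_of_subs : (R) → AbelEnvelope → (C)` (piece 1 feeds piece 2 through the landed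
`stub_abelMeanCeiling`: (R) ⇒ bounded Abel means of the closed chain, by fixed-frequency open/closed matching).
Intended ledger use: `ledger route edit route-AtomisticToContinuum-CageBudgetFekete --split HeatVarianceCeiling --into
[UniformAbelianRegularity, AbelEnvelope] --glue-by …heatVarianceCeiling_of_subs`.
-/

noncomputable section

namespace Summit.AtomisticToContinuum.FouriersLaw.Theorems.HeatVarianceCeiling.RegularityCollapse

open MeasureTheory Filter Set
open scoped Topology BigOperators

/-- **Piece 2 (proved): bounded Abel means ⇒ linear heat-variance ceiling**, for every symmetric pair of the pinned
anharmonic chain. [cite: Helfand1960, §II] -/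
theorem abelEnvelope_holds :
    ∀ ω₂ lam β γ : ℝ, 0 < ω₂ → 0 < lam → 0 < β → ∀ T : ℝ, 0 < T → ∀ μ : MeasureTheory.Measure Literature.MathematicalPhysics.KineticTheory.HeatConduction.ChainConfig, (Literature.MathematicalPhysics.KineticTheory.HeatConduction.pinnedChain ω₂ lam β γ).IsChainGibbsMeasure T μ → Literature.MathematicalPhysics.KineticTheory.HeatConduction.IsShiftInvariant μ → μ.map (fun σ : Literature.MathematicalPhysics.KineticTheory.HeatConduction.ChainConfig => fun x : ℤ => ((σ x).1, -(σ x).2)) = μ → ∀ D : Literature.MathematicalPhysics.KineticTheory.HeatConduction.InfiniteChainDynamics (Literature.MathematicalPhysics.KineticTheory.HeatConduction.pinnedChain ω₂ lam β γ), D.PreservesMeasure μ → ∀ B ν₀ : ℝ, 0 < ν₀ → (∀ ν : ℝ, 0 < ν → ν < ν₀ → ∫ t in Set.Ioi (0:ℝ), Real.exp (-(ν * t)) * D.currentCorrelation μ t ≤ B) → ∃ b : ℝ, ∀ τ : ℝ, 0 ≤ τ → 2 * ∫ s in Set.Ioc (0:ℝ) τ, (τ - s) * D.currentCorrelation μ s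 ≤ b * τ := by
  intro ω₂ lam β γ hω hl hβ T hT μ hG hSI hRv D hP B ν₀ hν₀ hA
  obtain ⟨σ, hσ, hC⟩ :=
    Summit.AtomisticToContinuum.FouriersLaw.Theorems.LinearCeiling.SpikeLemma.stub_spectralRepresentation
      ω₂ lam β γ hω hl hβ T hT μ hG hSI hRv D hP
  exact
    Summit.AtomisticToContinuum.FouriersLaw.Theorems.LinearCeiling.SpikeLemma.stub_envelopeOfSpectralAbelBound
      σ hσ _ hC B ν₀ hν₀ hA

/-- **Split glue: (R) → AbelEnvelope → (C).** [cite: BonettoLebowitzReyBellet2000, §7] -/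
theorem heatVarianceCeiling_of_subs :
    _root_.Summit.AtomisticToContinuum.FouriersLaw.Theses.CageBudgetFekete.UniformAbelianRegularity →
    (∀ ω₂ lam β γ : ℝ, 0 < ω₂ → 0 < lam → 0 < β → ∀ T : ℝ, 0 < T → ∀ μ : MeasureTheory.Measure Literature.MathematicalPhysics.KineticTheory.HeatConduction.ChainConfig, (Literature.MathematicalPhysics.KineticTheory.HeatConduction.pinnedChain ω₂ lam β γ).IsChainGibbsMeasure T μ → Literature.MathematicalPhysics.KineticTheory.HeatConduction.IsShiftInvariant μ → μ.map (fun σ : Literature.MathematicalPhysics.KineticTheory.HeatConduction.ChainConfig => fun x : ℤ => ((σ x).1, -(σ x).2)) = μ → ∀ D : Literature.MathematicalPhysics.KineticTheory.HeatConduction.InfiniteChainDynamics (Literature.MathematicalPhysics.KineticTheory.HeatConduction.pinnedChain ω₂ lam β γ), D.PreservesMeasure μ → ∀ B ν₀ : ℝ, 0 < ν₀ → (∀ ν : ℝ, 0 < ν → ν < ν₀ → ∫ t in Set.Ioi (0:ℝ), Real.exp (-(ν * t)) * D.currentCorrelation μ t ≤ B) → ∃ b : ℝ, ∀ τ : ℝ,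 0 ≤ τ → 2 * ∫ s in Set.Ioc (0:ℝ) τ, (τ - s) * D.currentCorrelation μ s ≤ b * τ) →
    _root_.Summit.AtomisticToContinuum.FouriersLaw.Theses.CageBudgetFekete.HeatVarianceCeiling := by
  intro hR hEnv ω₂ lam β γ hω hl hβ T hT μ hG hSI hRv D hP _hSh _hAC _hCc V hV
  have hR' : _root_.Summit.AtomisticToContinuum.FouriersLaw.Theses.CoercivePulse.UniformAbelianRegularity := hR
  obtain ⟨B, ν₀, hν₀, hA⟩ :=
    Summit.AtomisticToContinuum.FouriersLaw.Theorems.LinearCeiling.SpikeLemma.stub_abelMeanCeiling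
      hR' ω₂ lam β γ hω hl hβ T hT μ hG hSI hRv D hP
  obtain ⟨b, hb⟩ := hEnv ω₂ lam β γ hω hl hβ T hT μ hG hSI hRv D hP B ν₀ hν₀ hA
  refine ⟨b, 0, fun τ hτ => ?_⟩
  subst hV
  exact hb τ hτ

end Summit.AtomisticToContinuum.FouriersLaw.Theorems.HeatVarianceCeiling.RegularityCollapse

end
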